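import Literature.NumberTheory.DiophantineGeometry.MasserWustholzIsogenyTheorem
import Literature.NumberTheory.DiophantineGeometry.AVKernelHopf
import Literature.AlgebraicGeometry.Motives.AbelianVarietyKerRankProofs
import Literature.AlgebraicGeometry.Motives.AbelianVarietyDegreeGrowth
import Literature.AlgebraicGeometry.Motives.AbelianVarietyIsogenyProofs
import Literature.AlgebraicGeometry.Motives.AbelianVarietyLie
import HarnessLib

/-!
# The degree of the quasi-inverse of an isogeny; bounded isogeny degrees are direction-free

Pure-proof file (no definitions, no new named facts) in the vocabulary of
`Literature.AlgebraicGeometry.Motives.AbelianVariety`: isogenies `IsIsogeny`, the isogeny relation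
`IsIsogenous B A` ("there is an isogeny `B → A`"), and the degree `Hom.kerRank` (order of the
kernel group scheme, `AVIsogenyFlat`).

* `AbelianVariety.IsIsogeny.exists_comp_eq_kerRank_nsmul` — the quasi-inverse of an isogeny
  `f : A → B` may be taken with the multiplier `n = deg f` EXPLICIT: `g ∘ f = [deg f]_A`,
  `f ∘ g = [deg f]_B` (Mumford, *Abelian Varieties*, §19, Remark p. 169: "if `f` is an isogeny of
  degree `n`, `Ker f ⊂ X_n`, so `n_X` factors"; Görtz–Wedhorn II, Prop. 27.190 with Prop. 27.86).
  The tree's `IsIsogeny.exists_nsmul_inverse_holds` (`AVKernelHopf`) hides `n` behind an `∃`;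
  here it is pinned to `Hom.kerRank f` (`IsIsogeny.kerPoints_le_kerPoints_nsmul`, Deligne's
  theorem, and the quotient property `IsIsogeny.exists_comp_eq_of_kerPoints_le_holds`).
* `AbelianVariety.IsIsogeny.exists_isIsogeny_inverse_kerRank_mul`,
  `AbelianVariety.IsIsogeny.exists_isIsogeny_inverse_kerRank_eq` — over a field of characteristic
  `0` this quasi-inverse `g` is an isogeny with `deg f · deg g = deg [deg f]_A = (deg f)^{2 dim A}`
  (`kerRank_zsmul_id_holds`, Görtz–Wedhorn II, Prop. 27.186; multiplicativity
  `IsIsogeny.kerRank_comp`, Milne 1986, §8), i.e. **`deg g = (deg f)^{2 dim A - 1}`**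
  (Milne, *Abelian Varieties* (2008), I §7, proof of Thm. 7.2 / Rem. 7.3 shape; folklore).
* `AbelianVariety.IsIsogeny.exists_isIsogeny_reverse_kerRank_le` — hence an isogeny `A → B` of
  degree `≤ N` can be REVERSED into an isogeny `B → A` of degree `≤ N^{2 dim A - 1}`.
* `exists_isogeny_kerRank_le_iff_exists_isogeny_kerRank_le_reverse` — for a fixed `A` over a field
  of characteristic `0`, "the degrees of suitable isogenies `A → B` onto all `B` isogenous to `A`
  are bounded" iff "the degrees of suitable isogenies `B → A` from all such `B` are bounded": the
  qualitative isogeny bound is **direction-free** (isogenous varieties having equal dimension,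
  `dim_eq_of_isIsogenous_holds`).
* `exists_isogeny_kerRank_le_of_isIsogenous_iff_reverse` — the named fact
  `exists_isogeny_kerRank_le_of_isIsogenous A` (qualitative Masser–Wüstholz, Publ. Math. IHÉS 81
  (1995), Theorem II, p. 6, printed with "an isogeny from `A` to `A*`") is therefore equivalent to
  its variant with the bounded isogeny going INTO `A` (the shape of the "minimal isogeny" /
  "plus petite isogénie" statements, e.g. Gaudron–Rémond 2014, Thm. 1.4), so a discharge of either
  printed form discharges the fact; and `isogenyKernelBound_rat_iff_reverse` records the same for
  the `∀ A` statement over `ℚ` consumed on the summit side.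

## References

* [MumfordAV1970] D. Mumford, *Abelian Varieties*, §19, Remark before Thm. 1, p. 169.
* [GortzWedhorn2023] U. Görtz, T. Wedhorn, *Algebraic Geometry II*, Prop. 27.86, Prop. 27.186,
  Prop. 27.190.
* [Milne1986AbelianVarieties] J. S. Milne, *Abelian Varieties*, in Cornell–Silverman (1986), §8
  (degrees are multiplicative).
* [MasserWustholz1995] D. W. Masser, G. Wüstholz, Publ. Math. IHÉS 81 (1995), Theorem II (p. 6).

## Design

Namespace = directory (`Literature.NumberTheory.DiophantineGeometry`); the four lemmas about a
single isogeny are dot-notation extensions declared with their absolute names in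
`Literature.AlgebraicGeometry.Motives.AbelianVariety.IsIsogeny`, next to
`IsIsogeny.exists_nsmul_inverse_holds` and `IsIsogeny.kerRank_comp`. Characteristic `0` enters only
through `isIsogeny_zsmul_id_holds_of_charZero` (`[n]_A` is an isogeny for `n ≠ 0`).
-/

noncomputable section

universe u

open CategoryTheory AlgebraicGeometry

namespace Literature.NumberTheory.DiophantineGeometry

open Literature.AlgebraicGeometry.Motives (AbelianVariety)
open Literature.AlgebraicGeometry.Motives.AbelianVariety

variable {K : Type u} [Field K] {A B : AbelianVariety K}

/-! ### The quasi-inverse with explicit multiplier `deg f` -/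

/-- **Quasi-inverse with multiplier `deg f`.** If `f : A → B` is an isogeny of abelian varieties
over a field, there is a homomorphism `g : B → A` with `g ∘ f = [deg f]_A` and `f ∘ g = [deg f]_B`,
where `deg f = Hom.kerRank f` is the order of the kernel group scheme: `Ker f` is killed by its
order (Deligne; `IsIsogeny.kerPoints_le_kerPoints_nsmul`, Görtz–Wedhorn II, Prop. 27.86 with
Cor. 27.177), so `[deg f]_A` factors through the quotient `f` (`IsIsogeny.exists_comp_eq_of_kerPoints_le_holds`,
Prop. 27.54 and fpqc descent), and `f ∘ g = [deg f]_B` because `f` is an epimorphism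
(`IsIsogeny.cancel_left`) — the printed proof of Görtz–Wedhorn II, Prop. 27.190 (= Mumford, §19,
Remark p. 169: "if `f` is an isogeny of degree `n`, `ker f ⊂ X_n`, so `n_X` factors").
[cite: GortzWedhorn2023, Prop. 27.190] [cite: MumfordAV1970, §19 (remark before Thm. 1, p. 169)] -/
theorem _root_.Literature.AlgebraicGeometry.Motives.AbelianVariety.IsIsogeny.exists_comp_eq_kerRank_nsmul
    {f : A ⟶ B} (hf : IsIsogeny f) :
    ∃ g : B ⟶ A, f ≫ g = Hom.kerRank f • 𝟙 A ∧ g ≫ f = Hom.kerRank f • 𝟙 B := by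
  obtain ⟨g, hg⟩ := IsIsogeny.exists_comp_eq_of_kerPoints_le_holds hf (Hom.kerRank f • 𝟙 A)
    hf.kerPoints_le_kerPoints_nsmul
  refine ⟨g, hg, hf.cancel_left ?_⟩
  rw [← Category.assoc, hg, Preadditive.nsmul_comp, Preadditive.comp_nsmul, Category.id_comp,
    Category.comp_id]

/-! ### In characteristic zero the quasi-inverse is an isogeny of degree `(deg f)^(2 dim A - 1)` -/

/-- **The quasi-inverse is an isogeny, and `deg f · deg g = (deg f)^{2 dim A}`.** Over a field of
characteristic `0`, for an isogeny `f : A → B` the quasi-inverse `g : B → A` with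
`g ∘ f = [deg f]_A`, `f ∘ g = [deg f]_B` (`IsIsogeny.exists_comp_eq_kerRank_nsmul`) is an isogeny —
surjective because `g ∘ f = [deg f]_A` is (`isIsogeny_zsmul_id_holds_of_charZero`, Görtz–Wedhorn
II, Prop. 27.187), finite because `f ∘ g = [deg f]_B` is finite and `f` is separated — and
`deg f · deg g = deg (g ∘ f) = deg [deg f]_A = (deg f)^{2 dim A}` by multiplicativity of degrees
(`IsIsogeny.kerRank_comp`, Milne 1986, §8, p. 115) and `deg [n]_A = n^{2g}`
(`kerRank_zsmul_id_holds`, Görtz–Wedhorn II, Prop. 27.186).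
[cite: GortzWedhorn2023, Prop. 27.186 and Prop. 27.190] [cite: Milne1986AbelianVarieties, §8 (p. 115)] -/
theorem _root_.Literature.AlgebraicGeometry.Motives.AbelianVariety.IsIsogeny.exists_isIsogeny_inverse_kerRank_mul
    [CharZero K] {f : A ⟶ B} (hf : IsIsogeny f) :
    ∃ g : B ⟶ A, IsIsogeny g ∧ f ≫ g = Hom.kerRank f • 𝟙 A ∧ g ≫ f = Hom.kerRank f • 𝟙 B ∧
      Hom.kerRank f * Hom.kerRank g = Hom.kerRank f ^ (2 * A.dim) := by
  obtain ⟨g, hfg, hgf⟩ := hf.exists_comp_eq_kerRank_nsmul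
  have hpos : 0 < Hom.kerRank f := by
    haveI := hf.2
    exact Hom.kerRank_pos f
  have hn : (Hom.kerRank f : ℤ) ≠ 0 := by exact_mod_cast hpos.ne'
  have hfg' : f ≫ g = (Hom.kerRank f : ℤ) • 𝟙 A := by rw [hfg, natCast_zsmul]
  have hgf' : g ≫ f = (Hom.kerRank f : ℤ) • 𝟙 B := by rw [hgf, natCast_zsmul]
  have h1 : IsIsogeny (f ≫ g) := by
    rw [hfg']
    exact isIsogeny_zsmul_id_holds_of_charZero _ hn
  have h2 : IsIsogeny (g ≫ f) := by
    rw [hgf']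
    exact isIsogeny_zsmul_id_holds_of_charZero _ hn
  have hg : IsIsogeny g := by
    refine ⟨?_, ?_⟩
    · haveI : Surjective (Hom.toSchemeHom f ≫ Hom.toSchemeHom g) := by
        rw [← toSchemeHom_comp]
        exact h1.1
      exact Surjective.of_comp (Hom.toSchemeHom f) (Hom.toSchemeHom g)
    · haveI : IsFinite (Hom.toSchemeHom f) := hf.2
      have hsep : IsSeparated (Hom.toSchemeHom f) := IsSeparated.of_isAffineHom _
      have hfin : IsFinite (Hom.toSchemeHom g ≫ Hom.toSchemeHom f) := by
        rw [← toSchemeHom_comp]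
        exact h2.2
      exact MorphismProperty.of_postcomp (W := @IsFinite) (W' := @IsSeparated)
        (Hom.toSchemeHom g) (Hom.toSchemeHom f) hsep hfin
  refine ⟨g, hg, hfg, hgf, ?_⟩
  rw [← hf.kerRank_comp hg, hfg', kerRank_zsmul_id_holds A _ hn, Int.natAbs_natCast]

/-- **The degree of the quasi-inverse: `deg g = (deg f)^{2 dim A - 1}`.** Over a field of
characteristic `0`, an isogeny `f : A → B` has a quasi-inverse isogeny `g : B → A`
(`g ∘ f = [deg f]_A`, `f ∘ g = [deg f]_B`) of degree exactly `(deg f)^{2 dim A - 1}`: cancel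
`deg f ≥ 1` in `deg f · deg g = (deg f)^{2 dim A}` (`IsIsogeny.exists_isIsogeny_inverse_kerRank_mul`;
in dimension `0` both sides read `deg g = 1`). This is the usual count behind "reversing an
isogeny of degree `d` costs degree `d^{2g-1}`" (Mumford, §19, Remark p. 169, with
`deg n_X = n^{2g}`, §6, Application 3). [cite: GortzWedhorn2023, Prop. 27.186 and Prop. 27.190]
[cite: MumfordAV1970, §19 (remark before Thm. 1, p. 169)] -/
theorem _root_.Literature.AlgebraicGeometry.Motives.AbelianVariety.IsIsogeny.exists_isIsogeny_inverse_kerRank_eq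
    [CharZero K] {f : A ⟶ B} (hf : IsIsogeny f) :
    ∃ g : B ⟶ A, IsIsogeny g ∧ f ≫ g = Hom.kerRank f • 𝟙 A ∧ g ≫ f = Hom.kerRank f • 𝟙 B ∧
      Hom.kerRank g = Hom.kerRank f ^ (2 * A.dim - 1) := by
  obtain ⟨g, hg, hfg, hgf, hmul⟩ := hf.exists_isIsogeny_inverse_kerRank_mul
  refine ⟨g, hg, hfg, hgf, ?_⟩
  have hpos : 0 < Hom.kerRank f := by
    haveI := hf.2
    exact Hom.kerRank_pos f
  rcases Nat.eq_zero_or_pos A.dim with h0 | hdim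
  · -- dimension `0`: `deg f · deg g = 1`
    rw [h0, Nat.mul_zero, pow_zero] at hmul
    rw [h0, Nat.mul_zero, Nat.zero_sub, pow_zero]
    exact Nat.eq_one_of_mul_eq_one_left hmul
  · have h2 : 2 * A.dim = (2 * A.dim - 1) + 1 := by omega
    rw [h2, pow_succ'] at hmul
    exact Nat.eq_of_mul_eq_mul_left hpos hmul

/-- **Reversing an isogeny at bounded cost.** Over a field of characteristic `0`, if `f : A → B` is
an isogeny of degree `≤ N` then there is an isogeny `g : B → A` of degree `≤ N^{2 dim A - 1}`
(the quasi-inverse, `IsIsogeny.exists_isIsogeny_inverse_kerRank_eq`). [folklore] -/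
theorem _root_.Literature.AlgebraicGeometry.Motives.AbelianVariety.IsIsogeny.exists_isIsogeny_reverse_kerRank_le
    [CharZero K] {f : A ⟶ B} (hf : IsIsogeny f) {N : ℕ} (hN : Hom.kerRank f ≤ N) :
    ∃ g : B ⟶ A, IsIsogeny g ∧ Hom.kerRank g ≤ N ^ (2 * A.dim - 1) := by
  obtain ⟨g, hg, -, -, hdeg⟩ := hf.exists_isIsogeny_inverse_kerRank_eq
  exact ⟨g, hg, hdeg ▸ Nat.pow_le_pow_left hN _⟩

/-! ### Bounded isogeny degrees are direction-free -/

/-- **Bounded isogeny degrees are direction-free.** For an abelian variety `A` over a field of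
characteristic `0`, the following are equivalent: (i) there is `N` such that every `B` admitting an
isogeny `B → A` is the target of an isogeny `A → B` of degree `≤ N`; (ii) there is `N` such that
every such `B` admits an isogeny `B → A` of degree `≤ N`. Each direction reverses the given
isogeny at cost `N ↦ N^{2 dim A - 1}` (`IsIsogeny.exists_isIsogeny_reverse_kerRank_le`), using
`dim B = dim A` for `B` isogenous to `A` (`dim_eq_of_isIsogenous_holds`, Mumford §7, App. 3).
[folklore] -/
theorem exists_isogeny_kerRank_le_iff_exists_isogeny_kerRank_le_reverse [CharZero K]
    (A : AbelianVariety K) :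
    (∃ N : ℕ, ∀ B : AbelianVariety K, IsIsogenous B A →
        ∃ g : A ⟶ B, IsIsogeny g ∧ Hom.kerRank g ≤ N) ↔
      ∃ N : ℕ, ∀ B : AbelianVariety K, IsIsogenous B A →
        ∃ f : B ⟶ A, IsIsogeny f ∧ Hom.kerRank f ≤ N := by
  constructor
  · rintro ⟨N, hN⟩
    refine ⟨N ^ (2 * A.dim - 1), fun B hB => ?_⟩
    obtain ⟨g, hg, hle⟩ := hN B hB
    exact hg.exists_isIsogeny_reverse_kerRank_le hle
  · rintro ⟨N, hN⟩
    refine ⟨N ^ (2 * A.dim - 1), fun B hB => ?_⟩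
    obtain ⟨f, hf, hle⟩ := hN B hB
    obtain ⟨g, hg, hle'⟩ := hf.exists_isIsogeny_reverse_kerRank_le hle
    rw [dim_eq_of_isIsogenous_holds hB] at hle'
    exact ⟨g, hg, hle'⟩

/-- **The qualitative Masser–Wüstholz fact with the small isogeny going into `A`.** For an abelian
variety `A` over a field `K`, the named fact `exists_isogeny_kerRank_le_of_isIsogenous A`
(whenever `K` is a number field: bounded-degree isogenies `A → B` onto every `B` isogenous to `A`;
Masser–Wüstholz, Publ. Math. IHÉS 81 (1995), Theorem II, p. 6, "an isogeny from `A` to `A*`") is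
equivalent to the same statement with bounded-degree isogenies `B → A` (the "minimal isogeny into
`A`" shape), by `exists_isogeny_kerRank_le_iff_exists_isogeny_kerRank_le_reverse` (number fields
have characteristic `0`). A discharge of either printed direction therefore discharges the fact.
[cite: MasserWustholz1995, Theorem II (p. 6)] -/
theorem exists_isogeny_kerRank_le_of_isIsogenous_iff_reverse (A : AbelianVariety K) :
    exists_isogeny_kerRank_le_of_isIsogenous A ↔
      ∀ [NumberField K], ∃ N : ℕ, ∀ B : AbelianVariety K, IsIsogenous B A →
        ∃ f : B ⟶ A, IsIsogeny f ∧ Hom.kerRank f ≤ N := by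
  constructor
  · intro h hK
    exact (exists_isogeny_kerRank_le_iff_exists_isogeny_kerRank_le_reverse A).mp h
  · intro h hK
    exact (exists_isogeny_kerRank_le_iff_exists_isogeny_kerRank_le_reverse A).mpr h

/-- **Over `ℚ`, for all `A` at once**: the statement "for every abelian variety `A/ℚ` the degrees
of suitable isogenies `A → B` onto all `B/ℚ` isogenous to `A` are bounded" (the `∀ A` form of the
qualitative Masser–Wüstholz bound consumed on the summit side) is equivalent to its variant with
the bounded isogenies `B → A` (`exists_isogeny_kerRank_le_iff_exists_isogeny_kerRank_le_reverse`
pointwise in `A`). [cite: MasserWustholz1995, Theorem II (p. 6)] -/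
theorem isogenyKernelBound_rat_iff_reverse :
    (∀ A : AbelianVariety ℚ, ∃ N : ℕ, ∀ B : AbelianVariety ℚ, IsIsogenous B A →
        ∃ g : A ⟶ B, IsIsogeny g ∧ Hom.kerRank g ≤ N) ↔
      ∀ A : AbelianVariety ℚ, ∃ N : ℕ, ∀ B : AbelianVariety ℚ, IsIsogenous B A →
        ∃ f : B ⟶ A, IsIsogeny f ∧ Hom.kerRank f ≤ N :=
  forall_congr' fun A => exists_isogeny_kerRank_le_iff_exists_isogeny_kerRank_le_reverse A

end Literature.NumberTheory.DiophantineGeometry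

end
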